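import Summits.Schanuel.Schanuel.Theorems.ZilberEacInvariantDirectionDensity
import Summits.Schanuel.Schanuel.Theorems.ZilberEacInvariantDirectionRotation
import Summits.Schanuel.Schanuel.Theorems.ZilberEacRealHyperplaneCell
import HarnessLib

/-!
# Real hyperplanes with an integer relation: the rational-`λ` families of O49 (a) / O51 (a) are dense

Zilber's Exponential-Algebraic Closedness, case ladder (host summit Schanuel, cell `pub-schanuel`,
seat 2, gen 11).  For a REAL HYPERPLANE base `x_{s+1} = Σ rᵢ xᵢ + c` the cell's THEOREM R⁺ families
(`ZilberEacRealHyperplaneDensity`) are dense when the growth exponent `λ = Σ rᵢ dᵢ` is IRRATIONAL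
(THEOREM J); O49 (a) recorded the rational-`λ` families as open ("e.g. `x₂ = √2(x₀ - x₁)` with
`Aⱼ = Xⱼ`: `λ = 0`; along rays no coordinate has irrational power growth, THEOREM J silent").  When
the coefficients satisfy an INTEGER RELATION `Σ rᵢ qᵢ = 0` the base is invariant under the lattice
direction `q`, and the invariant-direction regime applies: existence near every shifted ray
(`ZilberEacInvariantDirectionExistence`), THEOREM L (`ZilberEacTransversalLimits`), and the
genericity of the limit family by ROTATION (`ZilberEacInvariantDirectionRotation`: the power
coordinate has constant modulus on the limit family and its phase `e^{2πi Σ rᵢ pᵢ}` is a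
non-periodic rotation as soon as some `Σ rᵢ ℓᵢ ∉ ℚ`).

* **THEOREM (`unprojectedDense_polyFibredGraph_hyperplane_invariant`).**  `r ∈ ℝ^{s+1}`, `c ∈ ℂ`,
  an integer relation `Σ rᵢ qᵢ = 0` (`q ∈ ℤ^{s+1}`), targets `Aⱼ` with leading forms non-vanishing
  at `2πi q` and degrees `dⱼ = λ qⱼ ≥ 1`, fibre polynomials `fⱼ ∈ ℂ[u]` arbitrary, and ONE lattice
  vector `ℓ` with `Σ rᵢ ℓᵢ ∉ ℚ` ⟹ the `(s+2)`-fold `{x_{s+1} = Σ rᵢxᵢ + c, yⱼ = Aⱼ(x) + y_{s+1}fⱼ(y_{s+1})}`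
  has `I(W ∩ Γ_exp) = I(W)`;
* certified members (`polyFibredGraph_hyperplane_invariant_member_dense`) and the example named in
  O49 (a): **`sqrtTwoDiff_member_dense`** — `{x₂ = √2(x₀ - x₁), y₀ = x₀ + y₂, y₁ = x₁ + y₂} ⊆ ℂ³ × ℂ³`
  (`e^z = z + e^{√2(z-w)}`, `e^w = w + e^{√2(z-w)}`; `λ = √2 - √2 = 0 ∈ ℚ`) is a certified member of
  `EC(3,2)`, not linearly split, with ZARISKI DENSE exponential points.

HONEST FRAMING: explicit families inside an OPEN cell; `EC(3,2)` OPEN; NOT Schanuel's conjecture;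
EAC ⇏ SC.
-/

noncomputable section

open Complex MvPolynomial Filter Topology
open Literature.NumberTheory.Transcendental Literature.ModelTheory.Zilber
  Literature.ModelTheory.ExponentialFields

set_option linter.dupNamespace false

namespace Summit.Schanuel.Schanuel.Theorems

/-! ## Part A. Density over bases invariant under `q` with a rotating transversal -/

section Density

variable {s : ℕ}

/-- **Density in the invariant-direction regime, rotation form.**  `g` invariant under `q`;
leading forms of the `Aⱼ` non-vanishing at `2πi q`, degrees `dⱼ = λ qⱼ ≥ 1`; fibre polynomials
arbitrary; and a lattice vector `ℓ` with `e^{g(x + 2πiℓ)} = ζ e^{g(x)}`, `|ζ| = 1` not a root of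
unity ⟹ `I(W ∩ Γ_exp) = I(W)`. (new)
[cite: MantovaMasser2023, §1 p.5 (the open case dim π(V) = 2 in ℂ³×ℂˣ³)] -/
theorem unprojectedDense_polyFibredGraph_invariantDirection_rotation
    (g : MvPolynomial (Fin (s + 1)) ℂ) (q : Fin (s + 1) → ℤ)
    (hper : ∀ (x : Fin (s + 1) → ℂ) (z : ℂ), eval (x + z • fun j => (q j : ℂ)) g = eval x g)
    (A : Fin (s + 1) → MvPolynomial (Fin (s + 1)) ℂ)
    (hA : ∀ j, eval (fun i => 2 * Real.pi * I * (q i : ℂ))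
      (homogeneousComponent (A j).totalDegree (A j)) ≠ 0)
    (lam : ℝ) (hlam : ∀ j, ((A j).totalDegree : ℝ) = lam * (q j : ℝ))
    (hdeg : ∀ j, 0 < (A j).totalDegree) (f : Fin (s + 1) → Polynomial ℂ)
    (ℓ : Fin (s + 1) → ℤ) (ζ : ℂ) (hζ1 : ‖ζ‖ = 1) (hroot : ∀ j : ℕ, 0 < j → ζ ^ j ≠ 1)
    (hshift : ∀ x : Fin (s + 1) → ℂ,
      exp (eval (x + fun i => 2 * Real.pi * I * (ℓ i : ℂ)) g) = ζ * exp (eval x g)) :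
    UnprojectedDense (polyFibredGraph g A (fun j => (f j).toMvPolynomial 0)) :=
  unprojectedDense_polyFibredGraph_invariantDirection_of_generic g q hper A hA lam hlam hdeg f
    (invariantDirection_limits_generic_of_rotation g ℓ ζ hζ1 hroot hshift _)

/-- `e^{2πiθ}` is not a root of unity for irrational `θ`. [folklore] -/
theorem exp_two_pi_I_mul_pow_ne_one {θ : ℝ} (hθ : Irrational θ) (j : ℕ) (hj : 0 < j) :
    exp (2 * Real.pi * I * (θ : ℂ)) ^ j ≠ 1 := by
  intro h
  rw [← Complex.exp_nat_mul, Complex.exp_eq_one_iff] at h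
  obtain ⟨n, hn⟩ := h
  apply hθ
  refine ⟨(n : ℚ) / (j : ℚ), ?_⟩
  have hjR : (j : ℝ) ≠ 0 := by exact_mod_cast hj.ne'
  have hre := congrArg Complex.im hn
  simp only [Complex.mul_im, Complex.mul_re, Complex.natCast_re, Complex.natCast_im,
    Complex.ofReal_re, Complex.ofReal_im, Complex.I_re, Complex.I_im, Complex.re_ofNat,
    Complex.im_ofNat, Complex.intCast_re, Complex.intCast_im, mul_zero, zero_mul, sub_zero,
    add_zero, mul_one, zero_add] at hre
  push_cast
  field_simp
  have hπ := Real.pi_ne_zero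
  have : (j : ℝ) * θ = n := by
    have h2 : (j : ℝ) * (2 * Real.pi * θ) = (n : ℝ) * (2 * Real.pi) := by linarith
    field_simp at h2
    nlinarith [h2, Real.pi_pos]
  linarith

/-- **THEOREM (real hyperplanes with an integer relation).**  See the module docstring. (new)
[cite: MantovaMasser2023, §1 p.5 (the open case dim π(V) = 2 in ℂ³×ℂˣ³)] -/
theorem unprojectedDense_polyFibredGraph_hyperplane_invariant (r : Fin (s + 1) → ℝ) (c : ℂ)
    (q : Fin (s + 1) → ℤ) (hq : ∑ i, r i * (q i : ℝ) = 0)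
    (A : Fin (s + 1) → MvPolynomial (Fin (s + 1)) ℂ)
    (hA : ∀ j, eval (fun i => 2 * Real.pi * I * (q i : ℂ))
      (homogeneousComponent (A j).totalDegree (A j)) ≠ 0)
    (lam : ℝ) (hlam : ∀ j, ((A j).totalDegree : ℝ) = lam * (q j : ℝ))
    (hdeg : ∀ j, 0 < (A j).totalDegree) (f : Fin (s + 1) → Polynomial ℂ)
    (ℓ : Fin (s + 1) → ℤ) (hirr : Irrational (∑ i, r i * (ℓ i : ℝ))) :
    UnprojectedDense (polyFibredGraph (hyperplanePoly r c) A (fun j => (f j).toMvPolynomial 0)) := by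
  have hqC : ∑ i, (r i : ℂ) * (q i : ℂ) = 0 := by
    have := congrArg (fun x : ℝ => (x : ℂ)) hq
    push_cast at this
    exact this
  refine unprojectedDense_polyFibredGraph_invariantDirection_rotation _ q (fun x z => ?_) A hA lam
    hlam hdeg f ℓ (exp (2 * Real.pi * I * ((∑ i, r i * (ℓ i : ℝ) : ℝ) : ℂ))) ?_
    (exp_two_pi_I_mul_pow_ne_one hirr) fun x => ?_
  · rw [eval_hyperplanePoly, eval_hyperplanePoly, ell, ell]
    simp only [Pi.add_apply, Pi.smul_apply, smul_eq_mul, mul_add, Finset.sum_add_distrib]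
    have : ∑ i, (r i : ℂ) * (z * (q i : ℂ)) = z * ∑ i, (r i : ℂ) * (q i : ℂ) := by
      rw [Finset.mul_sum]; exact Finset.sum_congr rfl fun i _ => by ring
    rw [this, hqC, mul_zero, add_zero]
  · rw [show (2 * Real.pi * I * ((∑ i, r i * (ℓ i : ℝ) : ℝ) : ℂ)) =
      ((2 * Real.pi * ∑ i, r i * (ℓ i : ℝ) : ℝ) : ℂ) * I by push_cast; ring]
    exact Complex.norm_exp_ofReal_mul_I _
  · rw [eval_hyperplanePoly, eval_hyperplanePoly, ell, ell, ← Complex.exp_add]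
    congr 1
    have h1 : ∑ i, (r i : ℂ) * ((x + fun i => 2 * Real.pi * I * (ℓ i : ℂ)) i) =
        ∑ i, (r i : ℂ) * x i + 2 * Real.pi * I * ∑ i, (r i : ℂ) * (ℓ i : ℂ) := by
      rw [Finset.mul_sum, ← Finset.sum_add_distrib]
      exact Finset.sum_congr rfl fun i _ => by simp only [Pi.add_apply]; ring
    rw [h1]
    push_cast
    ring

/-- **Certified members with dense exponential points over real hyperplanes with an integer
relation.**  `A` dominant; the hypotheses of the theorem: all seven hypotheses of
`ECCell (s+2) (s+1)` (`ecCell_hypotheses_polyFibredGraph_hyperplane`), not linearly split,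
`W ∩ Γ_exp ≠ ∅`, `I(W ∩ Γ_exp) = I(W)`. (new)
[cite: MantovaMasser2023, §1 p.5 (the open case dim π(V) = 2 in ℂ³×ℂˣ³)] -/
theorem polyFibredGraph_hyperplane_invariant_member_dense (r : Fin (s + 1) → ℝ) (c : ℂ)
    (q : Fin (s + 1) → ℤ) (hq : ∑ i, r i * (q i : ℝ) = 0)
    (A : Fin (s + 1) → MvPolynomial (Fin (s + 1)) ℂ)
    (hAinj : Function.Injective
      (aeval A : MvPolynomial (Fin (s + 1)) ℂ →ₐ[ℂ] MvPolynomial (Fin (s + 1)) ℂ))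
    (hA : ∀ j, eval (fun i => 2 * Real.pi * I * (q i : ℂ))
      (homogeneousComponent (A j).totalDegree (A j)) ≠ 0)
    (lam : ℝ) (hlam : ∀ j, ((A j).totalDegree : ℝ) = lam * (q j : ℝ))
    (hdeg : ∀ j, 0 < (A j).totalDegree) (f : Fin (s + 1) → Polynomial ℂ)
    (ℓ : Fin (s + 1) → ℤ) (hirr : Irrational (∑ i, r i * (ℓ i : ℝ))) :
    (IsIrreducibleClosed ℂ (polyFibredGraph (hyperplanePoly r c) A (fun j => (f j).toMvPolynomial 0)) ∧
      (polyFibredGraph (hyperplanePoly r c) A (fun j => (f j).toMvPolynomial 0) ∩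
        torusLocus ℂ (s + 2)).Nonempty ∧
      IsRotund ℂ (s + 2) (polyFibredGraph (hyperplanePoly r c) A (fun j => (f j).toMvPolynomial 0) ∩
        torusLocus ℂ (s + 2)) ∧
      IsAddFree ℂ (s + 2) (polyFibredGraph (hyperplanePoly r c) A (fun j => (f j).toMvPolynomial 0) ∩
        torusLocus ℂ (s + 2)) ∧
      IsMulFree ℂ (s + 2) (polyFibredGraph (hyperplanePoly r c) A (fun j => (f j).toMvPolynomial 0) ∩
        torusLocus ℂ (s + 2)) ∧
      zariskiDim ℂ (polyFibredGraph (hyperplanePoly r c) A (fun j => (f j).toMvPolynomial 0)) =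
        (s + 2 : ℕ) ∧
      addProjDim ℂ (s + 2) (polyFibredGraph (hyperplanePoly r c) A (fun j => (f j).toMvPolynomial 0)) =
        (s + 1 : ℕ)) ∧
    ¬ IsLinearSplit ℂ (s + 2) (polyFibredGraph (hyperplanePoly r c) A (fun j => (f j).toMvPolynomial 0)) ∧
    (polyFibredGraph (hyperplanePoly r c) A (fun j => (f j).toMvPolynomial 0) ∩
      expGraph ℂ (s + 2)).Nonempty ∧
    UnprojectedDense (polyFibredGraph (hyperplanePoly r c) A (fun j => (f j).toMvPolynomial 0)) := by
  -- some `rᵢ` is irrational (else `Σ rᵢ ℓᵢ ∈ ℚ`)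
  have hirr' : ∃ i, Irrational (r i) := by
    by_contra hall
    push Not at hall
    have hrat : ∀ i, ∃ ρ : ℚ, (ρ : ℝ) = r i := fun i => by
      have := hall i
      unfold Irrational at this
      push Not at this
      exact this
    choose ρ hρ using hrat
    apply hirr
    refine ⟨∑ i, ρ i * (ℓ i : ℚ), ?_⟩
    push_cast
    exact Finset.sum_congr rfl fun i _ => by rw [hρ i]
  have hcell := ecCell_hypotheses_polyFibredGraph_hyperplane r c A (fun j => (f j).toMvPolynomial 0)
    hAinj hirr'
  have hdense := unprojectedDense_polyFibredGraph_hyperplane_invariant r c q hq A hA lam hlam hdeg f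
    ℓ hirr
  refine ⟨hcell, not_isLinearSplit_polyFibredGraph _ A _ (Nat.succ_pos s) hAinj, ?_, hdense⟩
  obtain ⟨w, hw, -⟩ := hcell.2.1
  exact inter_expGraph_nonempty_of_vanishingIdeal_eq ⟨w, hw⟩ hdense

end Density

/-! ## Part B. The example of O49 (a): `x₂ = √2(x₀ - x₁)`, `yⱼ = xⱼ + y₂` -/

section Example

/-- **The rational-`λ` example of O49 (a) is dense.**
`W = {x₂ = √2x₀ - √2x₁, y₀ = x₀ + y₂, y₁ = x₁ + y₂} ⊆ ℂ³ × ℂ³` (`e^z = z + e^{√2(z-w)}`,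
`e^w = w + e^{√2(z-w)}`): all seven hypotheses of `ECCell 3 2`, not linearly split,
`W ∩ Γ_exp ≠ ∅` AND `I(W ∩ Γ_exp) = I(W)`.  The base is invariant under `q = (1,1)` (integer relation
`√2 - √2 = 0`) and rotates under `ℓ = (1,0)` (`√2 ∉ ℚ`). (new)
[cite: MantovaMasser2023, §1 p.5 (the open case dim π(V) = 2 in ℂ³×ℂˣ³)] -/
theorem sqrtTwoDiff_member_dense :
    (IsIrreducibleClosed ℂ (polyFibredGraph (hyperplanePoly ![Real.sqrt 2, -Real.sqrt 2] 0)
        (fun j => X j) (fun _ => 1)) ∧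
      (polyFibredGraph (hyperplanePoly ![Real.sqrt 2, -Real.sqrt 2] 0) (fun j => X j) (fun _ => 1) ∩
        torusLocus ℂ 3).Nonempty ∧
      IsRotund ℂ 3 (polyFibredGraph (hyperplanePoly ![Real.sqrt 2, -Real.sqrt 2] 0) (fun j => X j)
        (fun _ => 1) ∩ torusLocus ℂ 3) ∧
      IsAddFree ℂ 3 (polyFibredGraph (hyperplanePoly ![Real.sqrt 2, -Real.sqrt 2] 0) (fun j => X j)
        (fun _ => 1) ∩ torusLocus ℂ 3) ∧
      IsMulFree ℂ 3 (polyFibredGraph (hyperplanePoly ![Real.sqrt 2, -Real.sqrt 2] 0) (fun j => X j)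
        (fun _ => 1) ∩ torusLocus ℂ 3) ∧
      zariskiDim ℂ (polyFibredGraph (hyperplanePoly ![Real.sqrt 2, -Real.sqrt 2] 0) (fun j => X j)
        (fun _ => 1)) = (3 : ℕ) ∧
      addProjDim ℂ 3 (polyFibredGraph (hyperplanePoly ![Real.sqrt 2, -Real.sqrt 2] 0) (fun j => X j)
        (fun _ => 1)) = (2 : ℕ)) ∧
    ¬ IsLinearSplit ℂ 3 (polyFibredGraph (hyperplanePoly ![Real.sqrt 2, -Real.sqrt 2] 0)
        (fun j => X j) (fun _ => 1)) ∧
    (polyFibredGraph (hyperplanePoly ![Real.sqrt 2, -Real.sqrt 2] 0) (fun j => X j) (fun _ => 1) ∩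
        expGraph ℂ 3).Nonempty ∧
    UnprojectedDense (polyFibredGraph (hyperplanePoly ![Real.sqrt 2, -Real.sqrt 2] 0)
        (fun j => X j) (fun _ => 1)) := by
  have hAinj : Function.Injective (aeval (fun j : Fin 2 => (X j : MvPolynomial (Fin 2) ℂ)) :
      MvPolynomial (Fin 2) ℂ →ₐ[ℂ] MvPolynomial (Fin 2) ℂ) := by
    rw [aeval_X_left]; exact fun _ _ h => h
  have hF : (fun _ : Fin 2 => (1 : MvPolynomial (Fin 3) ℂ)) =
      fun j : Fin 2 => ((fun _ : Fin 2 => (1 : Polynomial ℂ)) j).toMvPolynomial 0 := by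
    funext j; simp
  have hlead : ∀ j : Fin 2, homogeneousComponent (X j : MvPolynomial (Fin 2) ℂ).totalDegree
      (X j : MvPolynomial (Fin 2) ℂ) = X j := fun j => by
    rw [totalDegree_X, homogeneousComponent_eq_self (isHomogeneous_X ℂ j)]
  have hA : ∀ j : Fin 2, eval (fun i => 2 * Real.pi * I * ((![1, 1] : Fin 2 → ℤ) i : ℂ))
      (homogeneousComponent (X j : MvPolynomial (Fin 2) ℂ).totalDegree
        (X j : MvPolynomial (Fin 2) ℂ)) ≠ 0 := by
    intro j
    rw [hlead j, eval_X]
    fin_cases j <;> simp [Real.pi_ne_zero, Complex.I_ne_zero]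
  have hlam : ∀ j : Fin 2, ((X j : MvPolynomial (Fin 2) ℂ).totalDegree : ℝ) =
      (1 : ℝ) * (((![1, 1] : Fin 2 → ℤ) j : ℤ) : ℝ) := by
    intro j
    rw [totalDegree_X]
    fin_cases j <;> simp
  have hdeg1 : ∀ j : Fin 2, 0 < (X j : MvPolynomial (Fin 2) ℂ).totalDegree := fun j => by
    rw [totalDegree_X]; exact Nat.one_pos
  have hq : ∑ i, (![Real.sqrt 2, -Real.sqrt 2] : Fin 2 → ℝ) i * (((![1, 1] : Fin 2 → ℤ) i : ℤ) : ℝ) = 0 := by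
    simp [Fin.sum_univ_two]
  have hirr : Irrational (∑ i, (![Real.sqrt 2, -Real.sqrt 2] : Fin 2 → ℝ) i *
      (((![1, 0] : Fin 2 → ℤ) i : ℤ) : ℝ)) := by
    simpa [Fin.sum_univ_two] using irrational_sqrt_two
  rw [hF]
  exact polyFibredGraph_hyperplane_invariant_member_dense _ 0 ![1, 1] hq _ hAinj hA 1 hlam hdeg1 _
    ![1, 0] hirr

end Example

end Summit.Schanuel.Schanuel.Theorems

end
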